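import Literature.AlgebraicGeometry.Frobenioids.ArchimedeanIsoSubanchors
import Mathlib.Data.Set.Finite.Basic
import HarnessLib

/-!
# [FrdII] Remark 3.5.1 — the named statement `ArchFrd.Rmk351` DISCHARGED (a kernel witness)

Mochizuki, *The geometry of Frobenioids II: poly-Frobenioids*, Kyushu J. Math. **62** (2008) 401–460, §3,
Remark 3.5.1 (kurims text p. 36) [cite: MochizukiFrdII2008, Rmk 3.5.1 p.36]: "it is not difficult to
construct examples of base categories … which have objects that are subanchors, but not anchors".
The statement file `ArchimedeanIsoSubanchors.lean` (seat abc-iut-L1-t9) types this assertion in the WEAK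
form `ArchFrd.Rmk351 : ∃ (T : Type u) (_ : Category.{v} T), IsTotallyEpimorphic T ∧ ∃ A : T,
IsSubanchor A ∧ ¬ IsAnchor A` ([FrdI] §0 vocabulary of `CategoriesFactorization.lean`).

This PROOF-ONLY file supplies the witness `ArchFrd.Rmk351_holds`, at every pair of universe levels:
the thin category on `T := ULift (Set ℕ)` with an arrow `X → Y` iff `X ⊆ Y` (hom-types
`ULift.{v} (PLift (X ⊆ Y))`, built inside the proof — no instance is declared).  In a thin category
every arrow is an epimorphism (`IsTotallyEpimorphic`); an arrow admitting an arrow in the opposite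
direction is an isomorphism.  The object `∅` has the infinitely many pairwise non-isomorphic
irreducible arrows `∅ → {n}` (`n : ℕ`), so it is NOT an anchor; the object `univ` admits only
isomorphisms out of it, so it IS an anchor, and `∅ → univ` makes `∅` a subanchor.  (The printed example
— the temperoid of a free tempered group — is recorded in the docstring of `Rmk351`; the weak form typed
there is what is witnessed here.)  Generic helper theorems about thin categories are stated over an
arbitrary `[Quiver.IsThin C]`.  Classical and undisputed; nothing here bears on [IUTchIII] Cor. 3.12;
FACT-LIST row F-0700.
-/

namespace Literature.AlgebraicGeometry.Frobenioids

open CategoryTheory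

universe v u

namespace ArchFrd

section Thin

variable {C : Type u} [Category.{v} C] [Quiver.IsThin C]

/-- In a thin category every arrow is an epimorphism, i.e. the category is totally epimorphic
([FrdI] §0). [cite: MochizukiFrdII2008, Rmk 3.5.1 p.36] -/
theorem isTotallyEpimorphic_of_isThin : IsTotallyEpimorphic C :=
  ⟨fun _ => ⟨fun _ _ _ => Subsingleton.elim _ _⟩⟩

/-- In a thin category an arrow `X → Y` admitting some arrow `Y → X` is an isomorphism.
[cite: MochizukiFrdII2008, Rmk 3.5.1 p.36] -/
theorem isIso_of_isThin {X Y : C} (f : X ⟶ Y) (g : Y ⟶ X) : IsIso f :=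
  ⟨⟨g, Subsingleton.elim _ _, Subsingleton.elim _ _⟩⟩

/-- In a thin category an endomorphism is an isomorphism. [cite: MochizukiFrdII2008, Rmk 3.5.1 p.36] -/
theorem isIso_endo_of_isThin {X : C} (f : X ⟶ X) : IsIso f :=
  isIso_of_isThin f f

end Thin

section Anchors

variable {C : Type u} [Category.{v} C]

/-- An object all of whose outgoing arrows are isomorphisms is an anchor: no irreducible arrow leaves
it, so the set of isomorphism classes in question is empty ([FrdI] §0 "anchor").
[cite: MochizukiFrdII2008, Rmk 3.5.1 p.36] -/
theorem isAnchor_of_forall_isIso (A : C) (h : ∀ (B : C) (f : A ⟶ B), IsIso f) : IsAnchor A := by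
  have he : {x : Quotient (isIsomorphicSetoid (Under A)) |
      ∃ f : Under A, IsIrreducibleHom f.hom ∧ Quotient.mk _ f = x} = ∅ := by
    ext x
    simp only [Set.mem_setOf_eq, Set.mem_empty_iff_false, iff_false, not_exists, not_and]
    intro f hf
    exact (hf.1 (h f.right f.hom)).elim
  unfold IsAnchor
  rw [he]
  exact Set.finite_empty

/-- An object with a sequence of irreducible arrows `A → B n` to pairwise non-isomorphic targets is
NOT an anchor ([FrdI] §0 "anchor": infinitely many isomorphism classes of `^A C` arise from irreducible
arrows). [cite: MochizukiFrdII2008, Rmk 3.5.1 p.36] -/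
theorem not_isAnchor_of_irreducible_family (A : C) (B : ℕ → C) (f : ∀ n, A ⟶ B n)
    (hirr : ∀ n, IsIrreducibleHom (f n)) (hsep : ∀ m n, Nonempty (B m ≅ B n) → m = n) :
    ¬ IsAnchor A := by
  intro hA
  unfold IsAnchor at hA
  refine Set.infinite_of_injective_forall_mem (f := fun n : ℕ =>
    Quotient.mk (isIsomorphicSetoid (Under A)) (Under.mk (f n))) ?_ ?_ hA
  · intro m n hmn
    have hmn' : Nonempty (Under.mk (f m) ≅ Under.mk (f n)) := Quotient.exact hmn
    obtain ⟨i⟩ := hmn'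
    exact hsep m n ⟨(Under.forget A).mapIso i⟩
  · intro n
    exact ⟨Under.mk (f n), hirr n, rfl⟩

end Anchors

/-- **[FrdII] Remark 3.5.1, the named statement `Rmk351` DISCHARGED**: there is a totally epimorphic
category with an object that is a subanchor but not an anchor.  Witness (all universe levels): the
thin category on `ULift (Set ℕ)` ordered by inclusion; `∅` is a subanchor (via `∅ → univ`, `univ` an
anchor) with the infinitely many pairwise non-isomorphic irreducible arrows `∅ → {n}`.
[cite: MochizukiFrdII2008, Rmk 3.5.1 p.36] -/
theorem Rmk351_holds : Rmk351.{v, u} := by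
  classical
  -- the witness category: objects `ULift (Set ℕ)`, an arrow `X → Y` iff `X.down ⊆ Y.down`
  let T : Type u := ULift.{u} (Set ℕ)
  letI inst : Category.{v} T :=
    { Hom := fun X Y => ULift.{v} (PLift (X.down ⊆ Y.down))
      id := fun X => ⟨⟨subset_rfl⟩⟩
      comp := fun f g => ⟨⟨f.down.down.trans g.down.down⟩⟩
      id_comp := fun _ => rfl
      comp_id := fun _ => rfl
      assoc := fun _ _ _ => rfl }
  haveI hthin : Quiver.IsThin T := fun X Y =>
    ⟨fun a b => by
      cases a; cases b
      congr 1
      exact Subsingleton.elim _ _⟩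
  -- reading arrows as inclusions and back
  have le_of_hom : ∀ {X Y : T}, (X ⟶ Y) → X.down ⊆ Y.down := fun h => h.down.down
  have hom_of_le : ∀ {X Y : T}, X.down ⊆ Y.down → (X ⟶ Y) := fun h => ⟨⟨h⟩⟩
  refine ⟨T, inst, isTotallyEpimorphic_of_isThin, ⟨(∅ : Set ℕ)⟩, ?_, ?_⟩
  · -- `∅` is a subanchor: `∅ → univ`, and every arrow out of `univ` is an isomorphism
    refine ⟨⟨(Set.univ : Set ℕ)⟩, isAnchor_of_forall_isIso _ fun B g => ?_, ⟨hom_of_le (Set.empty_subset _)⟩⟩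
    exact isIso_of_isThin g (hom_of_le (Set.subset_univ _))
  · -- `∅` is not an anchor: the arrows `∅ → {n}` are irreducible with pairwise non-isomorphic targets
    refine not_isAnchor_of_irreducible_family _ (fun n => ⟨({n} : Set ℕ)⟩)
      (fun n => hom_of_le (Set.empty_subset _)) (fun n => ⟨fun hiso => ?_, fun X β α _ => ?_⟩)
      (fun m n hmn => ?_)
    · -- not an isomorphism: there is no arrow `{n} → ∅`
      have h := le_of_hom (inv (hom_of_le (Set.empty_subset ({n} : Set ℕ)) :
        (⟨(∅ : Set ℕ)⟩ : T) ⟶ ⟨({n} : Set ℕ)⟩))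
      exact (h (Set.mem_singleton n)).elim
    · -- a factorisation `∅ → X → {n}` has `X = ∅` or `X = {n}`
      rcases (Set.subset_singleton_iff_eq.1 (le_of_hom α)) with hX | hX
      · refine Or.inr (isIso_of_isThin β (hom_of_le ?_))
        rw [hX]
      · refine Or.inl (isIso_of_isThin α (hom_of_le ?_))
        rw [hX]
    · -- `{m} ≅ {n}` forces `m = n`
      obtain ⟨i⟩ := hmn
      have h : ({m} : Set ℕ) ⊆ {n} := le_of_hom i.hom
      exact Set.singleton_subset_singleton.1 h

end ArchFrd

end Literature.AlgebraicGeometry.Frobenioids
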